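import Literature.NumberTheory.Automorphic.LocalTypeSphericalAlmostAll
import Literature.NumberTheory.Automorphic.UnitaryGroupPlaceInclusion
import HarnessLib

/-!
# The local types of an admissible representation of `U(J)(𝔸_{F,f})` are admissible and almost everywhere spherical

Topic `NumberTheory/Automorphic`; the `U(J)(𝔸_{F,f})` edition of ★ `LocalTypeSphericalAlmostAll` (the dimension count over an abstract
restricted product `Πʳ_i [G i, K i]`), transported along the tree's ★ `UnitaryGroup.finAdelicEquiv :
U(J)(𝔸_{F,f}) ≃ₜ* Πʳ_v [U(J)(F_v), U(J)(𝒪_v)]` and ★ `UnitaryGroup.inclPlace v = finAdelicEquiv⁻¹ ∘ mulSingleHom _ v`.  THEOREMS ONLY.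

For a number-field extension `E/F`, `c ∈ Aut(E/F)`, `J ∈ M_N(E)`, an ADMISSIBLE representation `ω` of `U(J)(𝔸_{F,f}) = finAdelic F E c N J`
on `W ≠ 0`, and at every finite place `v` of `F` an irreducible `τ_v : U(J)(F_v) → GL(T_v)` with `ω ∘ inclPlace v` `τ_v`-isotypic (the
hypothesis text of the (C)-line's `IsLocalTypeAt F E c N J ω v τ_v`, unfolded):
* `isAdmissible_comp_continuousMulEquiv` — admissibility is transported along an isomorphism of topological groups (generic);
* **`isAdmissible_localType`** — every `τ_v` is admissible;
* **`localType_exists_eq_smul`** — every self-intertwiner of `τ_v` is a scalar;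
* **`isSpherical_localType_cofinite`** — `τ_v` is `U(J)(𝒪_v)`-spherical (`dim τ_v^{U(J)(𝒪_v)} = 1`) for all but finitely many `v`.
(Flath 1979, Thm. 2 and §2 Example 2; Bump 1997, §3.4.)  Cell hodgecm-mathlib, floor 0, (C)-line `F0_P2CohFinComponentIsThetaC`, stub CF, road
file (4b).

## References
* D. Flath, *Decomposition of representations into tensor products*, PSPM 33.1 (1979), §2 Example 2, Theorem 2.
* D. Bump, *Automorphic Forms and Representations* (1997), §3.4, Prop. 3.4.2; Prop. 4.2.4.
-/

set_option autoImplicit false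

noncomputable section

open NumberField IsDedekindDomain Filter Module

open scoped RestrictedProduct MonoidAlgebra Classical

namespace Literature.NumberTheory.Automorphic

/-- **Admissibility is transported along an isomorphism of topological groups**: if `ρ : G → GL(V)` is admissible and `e : G' ≃ₜ* G`,
then `ρ ∘ e` is admissible (stabilisers are preimages under `e`; `(ρ ∘ e)`-fixed vectors of a compact open `U ≤ G'` are the `ρ`-fixed
vectors of the compact open `e(U)`). [cite: Bump1997, Prop. 3.4.2] -/
theorem isAdmissible_comp_continuousMulEquiv {k : Type*} [Field k] {G G' : Type*} [Group G] [Group G'] [TopologicalSpace G]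
    [TopologicalSpace G'] {V : Type*} [AddCommGroup V] [Module k V] {ρ : Representation k G V} (hρ : ρ.IsAdmissible)
    (e : G' ≃ₜ* G) : Representation.IsAdmissible (ρ.comp e.toMonoidHom) := by
  refine ⟨fun v => ?_, fun U hU => ?_⟩
  · change IsOpen ((Representation.stabilizerSubgroup (ρ.comp e.toMonoidHom) v : Set G'))
    have : (Representation.stabilizerSubgroup (ρ.comp e.toMonoidHom) v : Set G') = e ⁻¹' (ρ.stabilizerSubgroup v : Set G) := by
      ext g
      rfl
    rw [this]
    exact (hρ.1 v).preimage e.continuous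
  · have hfix : Representation.fixedPoints (ρ.comp e.toMonoidHom) (U : Subgroup G') =
        ρ.fixedPoints ((U : Subgroup G').map e.toMonoidHom) := by
      ext w
      simp only [Representation.mem_fixedPoints]
      constructor
      · rintro h _ ⟨g, hg, rfl⟩
        exact h g hg
      · intro h g hg
        exact h (e.toMonoidHom g) ⟨g, hg, rfl⟩
    rw [hfix]
    have hcoe : (((U : Subgroup G').map e.toMonoidHom : Subgroup G) : Set G) = e '' (U : Set G') := Subgroup.coe_map _ _
    have hopen : IsOpen (((U : Subgroup G').map e.toMonoidHom : Subgroup G) : Set G) := by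
      rw [hcoe]
      exact e.toHomeomorph.isOpenMap _ U.isOpen
    have hcpt : IsCompact (((U : Subgroup G').map e.toMonoidHom : Subgroup G) : Set G) := by
      rw [hcoe]
      exact hU.image e.continuous
    exact hρ.2 ⟨(U : Subgroup G').map e.toMonoidHom, hopen⟩ hcpt

namespace UnitaryGroup

variable (F E : Type) [Field F] [NumberField F] [Field E] [NumberField E] [Algebra F E]
  (c : E ≃ₐ[F] E) (N : ℕ) (J : Matrix (Fin N) (Fin N) E)

universe w w'

variable {W : Type w} [AddCommGroup W] [Module ℂ W] (ω : Representation ℂ (finAdelic F E c N J) W)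
  {T : HeightOneSpectrum (𝓞 F) → Type w'} [∀ v, AddCommGroup (T v)] [∀ v, Module ℂ (T v)]
  (τ : ∀ v, Representation ℂ (localPi E c N J v) (T v))

/-- `ω` read on the restricted product `Πʳ_v [U(J)(F_v), U(J)(𝒪_v)]` through `finAdelicEquiv`, restricted to the `v`-th coordinate, IS
`ω ∘ inclPlace v` (definitionally: `inclPlace v = finAdelicEquiv⁻¹ ∘ mulSingleHom _ v`). [cite: FlathCorvallis1979, §2 Example 2] -/
theorem comp_finAdelicEquiv_symm_comp_mulSingleHom (v : HeightOneSpectrum (𝓞 F)) :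
    (ω.comp (finAdelicEquiv F E c N J).symm.toMonoidHom).comp
        (mulSingleHom (fun v : HeightOneSpectrum (𝓞 F) => localInt E c N J v) v) =
      ω.comp (inclPlace F E c N J v) := rfl

/-- The transported representation `ω ∘ finAdelicEquiv⁻¹` of `Πʳ_v [U(J)(F_v), U(J)(𝒪_v)]` is admissible when `ω` is.
[cite: FlathCorvallis1979, §2 Example 2] -/
theorem isAdmissible_comp_finAdelicEquiv_symm (hω : ω.IsAdmissible) :
    Representation.IsAdmissible (ω.comp (finAdelicEquiv F E c N J).symm.toMonoidHom) :=
  isAdmissible_comp_continuousMulEquiv hω (finAdelicEquiv F E c N J).symm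

/-- **The local types of an admissible representation of `U(J)(𝔸_{F,f})` are admissible.**  `ω` admissible on `W ≠ 0`, `τ_v` irreducible
with `ω ∘ inclPlace v` `τ_v`-isotypic ⇒ `τ_v` admissible (★ `LocalTypeSpherical.isAdmissible_localType` through `finAdelicEquiv`;
`U(J)(𝒪_w)` compact open ★ `isOpen_localInt`, `isCompact_localInt`). [cite: FlathCorvallis1979, §2 Example 2] [cite: Bump1997, Prop. 3.4.2] -/
theorem isAdmissible_localType (hω : ω.IsAdmissible) [Nontrivial W] (v : HeightOneSpectrum (𝓞 F)) [(τ v).IsIrreducible]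
    (hiso : isotypicComponent (MonoidAlgebra ℂ (localPi E c N J v)) (Representation.asModule (ω.comp (inclPlace F E c N J v)))
      (Representation.asModule (τ v)) = ⊤) :
    (τ v).IsAdmissible :=
  LocalTypeSpherical.isAdmissible_localType (ω.comp (finAdelicEquiv F E c N J).symm.toMonoidHom) τ
    (fun w => isOpen_localInt E c N J w) (fun w => isCompact_localInt E c N J w) (isAdmissible_comp_finAdelicEquiv_symm F E c N J ω hω)
    v hiso

/-- **Schur for the local types of an admissible representation of `U(J)(𝔸_{F,f})`**: every self-intertwiner of `τ_v` is a scalar.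
[cite: Bump1997, Proposition 4.2.4] -/
theorem localType_exists_eq_smul (hω : ω.IsAdmissible) [Nontrivial W] (v : HeightOneSpectrum (𝓞 F)) [(τ v).IsIrreducible]
    (hiso : isotypicComponent (MonoidAlgebra ℂ (localPi E c N J v)) (Representation.asModule (ω.comp (inclPlace F E c N J v)))
      (Representation.asModule (τ v)) = ⊤) (φ : (τ v).IntertwiningMap (τ v)) :
    ∃ a : ℂ, ∀ x, φ x = a • x :=
  LocalTypeSpherical.localType_exists_eq_smul (ω.comp (finAdelicEquiv F E c N J).symm.toMonoidHom) τ
    (fun w => isOpen_localInt E c N J w) (fun w => isCompact_localInt E c N J w) (isAdmissible_comp_finAdelicEquiv_symm F E c N J ω hω)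
    v hiso φ

/-- **The local types of an admissible representation of `U(J)(𝔸_{F,f})` are spherical at almost every place** (the dimension count,
★ `LocalTypeSpherical.isSpherical_localType_cofinite`, through `finAdelicEquiv`): `ω` admissible on `W ≠ 0` (e.g. irreducible admissible),
`τ_v` irreducible with `ω ∘ inclPlace v` `τ_v`-isotypic at every finite place `v` ⇒ `dim τ_v^{U(J)(𝒪_v)} = 1` for all but finitely many `v`.
(Flath 1979, Thm. 2: the local components of an admissible irreducible representation are class one almost everywhere.)
[cite: FlathCorvallis1979, §2 Example 2] [cite: Bump1997, Prop. 3.4.2] -/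
theorem isSpherical_localType_cofinite (hω : ω.IsAdmissible) [Nontrivial W]
    (hτ : ∀ v, (τ v).IsIrreducible ∧
      isotypicComponent (MonoidAlgebra ℂ (localPi E c N J v)) (Representation.asModule (ω.comp (inclPlace F E c N J v)))
        (Representation.asModule (τ v)) = ⊤) :
    ∀ᶠ v in cofinite, (τ v).IsSpherical (localInt E c N J v) :=
  LocalTypeSpherical.isSpherical_localType_cofinite (ω.comp (finAdelicEquiv F E c N J).symm.toMonoidHom) τ
    (fun w => isOpen_localInt E c N J w) (fun w => isCompact_localInt E c N J w) (isAdmissible_comp_finAdelicEquiv_symm F E c N J ω hω)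
    (fun v => (hτ v).1) (fun v => (hτ v).2)

end UnitaryGroup

/-! ## Single-place editions (one local type `τ` at one place, the binder shape of the (C)-line's CF closer) -/

namespace LocalTypeSpherical

universe u₁ v₁ w₁ w₂ uk₁

variable {ι : Type u₁} [DecidableEq ι] {G : ι → Type v₁} [∀ i, Group (G i)] {K : ∀ i, Subgroup (G i)} {k : Type uk₁} [Field k]
  {W : Type w₁} [AddCommGroup W] [Module k W] (π : Representation k (Πʳ i, [G i, K i]) W)
  [∀ i, TopologicalSpace (G i)] [∀ i, IsTopologicalGroup (G i)]

/-- **The local type at ONE place of an admissible representation is admissible** (single-type edition of ★ `isAdmissible_localType`,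
same proof): `K i` compact open, `π` admissible on `W ≠ 0`, `σ` an irreducible representation of `G i` with `π ∘ ι_i` `σ`-isotypic ⇒ `σ`
admissible. [cite: FlathCorvallis1979, §2 Example 2] [cite: Bump1997, Prop. 3.4.2] -/
theorem isAdmissible_of_isotypic (hK : ∀ i, IsOpen (K i : Set (G i))) (hKc : ∀ i, IsCompact (K i : Set (G i)))
    (hadm : π.IsAdmissible) [Nontrivial W] (i : ι) {S : Type w₂} [AddCommGroup S] [Module k S] (σ : Representation k (G i) S)
    [σ.IsIrreducible] (hiso : isotypicComponent k[G i] (Representation.asModule (π.comp (mulSingleHom K i))) σ.asModule = ⊤) :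
    σ.IsAdmissible := by
  classical
  obtain ⟨f, hf⟩ := exists_injective_intertwiningMap σ (π.comp (mulSingleHom K i)) hiso
  have hfg : ∀ (g : G i) (t : S), f (σ g t) = π (mulSingleHom K i g) (f t) := fun g t => by
    rw [f.isIntertwining]; rfl
  have hsm : σ.IsSmooth := by
    intro t
    have hst : σ.stabilizerSubgroup t = (π.stabilizerSubgroup (f t)).comap (mulSingleHom K i) := by
      ext g
      simp only [Representation.mem_stabilizerSubgroup, Subgroup.mem_comap]
      rw [← hfg]
      exact ⟨fun h => by rw [h], fun h => hf h⟩
    change IsOpen ((σ.stabilizerSubgroup t : Set (G i)))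
    rw [hst]
    exact (hadm.1 (f t)).preimage (continuous_mulSingleHom i)
  refine ⟨hsm, fun U hU => ?_⟩
  haveI : Nontrivial S := Representation.IsIrreducible.nontrivial σ
  obtain ⟨t₀, ht₀⟩ := exists_ne (0 : S)
  obtain ⟨L, hLo, hLc, hLK, hLK', hsub⟩ := exists_boxSubgroup_le_of_mem_nhds hK hKc (π.stabilizerSubgroup (f t₀))
    ((hadm.1 (f t₀)).mem_nhds (π.stabilizerSubgroup (f t₀)).one_mem)
  have hW' : ∀ t, f t ∈ π.fixedPoints (boxSubgroup (Function.update L i ⊥)) := by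
    let N : Subrepresentation σ :=
      ⟨(π.fixedPoints (boxSubgroup (Function.update L i ⊥))).comap f.toLinearMap, fun g t ht => by
        simp only [Submodule.mem_comap, Representation.IntertwiningMap.toLinearMap_apply] at ht ⊢
        rw [hfg]
        exact span_range_mulSingleHom_le_fixedPoints_update_bot π L i ht (Submodule.subset_span ⟨g, rfl⟩)⟩
    have hNtop : N = ⊤ := by
      rcases IsSimpleOrder.eq_bot_or_eq_top N with h | h
      · exfalso
        have ht₀N : t₀ ∈ N.toSubmodule := by
          change f t₀ ∈ π.fixedPoints (boxSubgroup (Function.update L i ⊥))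
          refine mem_fixedPoints_boxSubgroup_update_bot π L i ?_
          rw [Representation.mem_fixedPoints]
          intro c hc
          exact hsub hc
        rw [h] at ht₀N
        exact ht₀ ((Submodule.mem_bot k).1 ht₀N)
      · exact h
    intro t
    have ht : t ∈ N.toSubmodule := by rw [hNtop]; trivial
    exact ht
  set L' : Subgroup (G i) := (U : Subgroup (G i)) ⊓ K i with hL'
  have hL'o : IsOpen (L' : Set (G i)) := U.isOpen.inter (hK i)
  have hL'c : IsCompact (L' : Set (G i)) :=
    (hKc i).of_isClosed_subset (L'.isClosed_of_isOpen hL'o) fun g hg => hg.2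
  haveI := finite_fixedPoints_boxSubgroup_update π hadm hLo hLc hLK hLK' i hL'o hL'c (inf_le_right : L' ≤ K i)
  have hmap : ∀ t ∈ σ.fixedPoints (U : Subgroup (G i)),
      f.toLinearMap t ∈ π.fixedPoints (boxSubgroup (Function.update L i L')) := by
    intro t ht
    rw [mem_fixedPoints_boxSubgroup_update_iff]
    refine ⟨hW' t, ?_⟩
    rw [Representation.mem_fixedPoints] at ht ⊢
    intro g hg
    change π (mulSingleHom K i g) (f t) = f t
    rw [← hfg, ht g hg.1]
  exact Module.Finite.of_injective (f.toLinearMap.restrict hmap) fun x y hxy =>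
    Subtype.ext (hf (congrArg Subtype.val hxy :))

/-- Single-type Schur: every self-intertwiner of the local type `σ` at one place of an admissible `π` is a scalar (`k` algebraically
closed). [cite: Bump1997, Proposition 4.2.4] -/
theorem exists_eq_smul_of_isotypic [IsAlgClosed k] (hK : ∀ i, IsOpen (K i : Set (G i)))
    (hKc : ∀ i, IsCompact (K i : Set (G i))) (hadm : π.IsAdmissible) [Nontrivial W] (i : ι) {S : Type w₂} [AddCommGroup S]
    [Module k S] (σ : Representation k (G i) S) [σ.IsIrreducible]
    (hiso : isotypicComponent k[G i] (Representation.asModule (π.comp (mulSingleHom K i))) σ.asModule = ⊤)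
    (φ : σ.IntertwiningMap σ) : ∃ c : k, ∀ x, φ x = c • x := by
  obtain ⟨c, hc⟩ := Representation.IsAdmissible.exists_eq_smul_id (isAdmissible_of_isotypic π hK hKc hadm i σ hiso) (hK i)
    (hKc i) φ.toLinearMap φ.isIntertwining'
  exact ⟨c, fun x => by simpa using LinearMap.congr_fun hc x⟩

end LocalTypeSpherical

namespace UnitaryGroup

variable (F E : Type) [Field F] [NumberField F] [Field E] [NumberField E] [Algebra F E]
  (c : E ≃ₐ[F] E) (N : ℕ) (J : Matrix (Fin N) (Fin N) E)

universe w₃ w₄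

variable {W : Type w₃} [AddCommGroup W] [Module ℂ W]

/-- **(4a) of the CF closer, token-for-token: the local type `τ` of an irreducible admissible `ω` at the place `v` is admissible.**
[cite: FlathCorvallis1979, §2 Example 2] [cite: Bump1997, Prop. 3.4.2] -/
theorem localType_isAdmissible (ω : Representation ℂ (finAdelic F E c N J) W) (hirr : ω.IsIrreducible) (hω : ω.IsAdmissible)
    (v : HeightOneSpectrum (𝓞 F)) {T : Type w₄} [AddCommGroup T] [Module ℂ T] (τ : Representation ℂ (localPi E c N J v) T)
    (hτirr : τ.IsIrreducible)
    (hτ : isotypicComponent (MonoidAlgebra ℂ (localPi E c N J v)) (Representation.asModule (ω.comp (inclPlace F E c N J v)))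
      (Representation.asModule τ) = ⊤) :
    τ.IsAdmissible := by
  haveI : Nontrivial W := Representation.IsIrreducible.nontrivial ω
  haveI := hirr
  haveI := hτirr
  exact LocalTypeSpherical.isAdmissible_of_isotypic (ω.comp (finAdelicEquiv F E c N J).symm.toMonoidHom)
    (fun w => isOpen_localInt E c N J w) (fun w => isCompact_localInt E c N J w) (isAdmissible_comp_finAdelicEquiv_symm F E c N J ω hω)
    v τ hτ

/-- Single-type Schur for the local type `τ` of an irreducible admissible `ω` at `v`: self-intertwiners of `τ` are scalars.
[cite: Bump1997, Proposition 4.2.4] -/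
theorem localType_exists_eq_smul' (ω : Representation ℂ (finAdelic F E c N J) W) (hirr : ω.IsIrreducible) (hω : ω.IsAdmissible)
    (v : HeightOneSpectrum (𝓞 F)) {T : Type w₄} [AddCommGroup T] [Module ℂ T] (τ : Representation ℂ (localPi E c N J v) T)
    (hτirr : τ.IsIrreducible)
    (hτ : isotypicComponent (MonoidAlgebra ℂ (localPi E c N J v)) (Representation.asModule (ω.comp (inclPlace F E c N J v)))
      (Representation.asModule τ) = ⊤) (φ : τ.IntertwiningMap τ) :
    ∃ a : ℂ, ∀ x, φ x = a • x := by
  haveI : Nontrivial W := Representation.IsIrreducible.nontrivial ω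
  haveI := hτirr
  exact LocalTypeSpherical.exists_eq_smul_of_isotypic (ω.comp (finAdelicEquiv F E c N J).symm.toMonoidHom)
    (fun w => isOpen_localInt E c N J w) (fun w => isCompact_localInt E c N J w) (isAdmissible_comp_finAdelicEquiv_symm F E c N J ω hω)
    v τ hτ φ

/-- **(4b) of the CF closer, with the irreducibility and isotypy hypotheses as two separate binders**: the local types of an admissible `ω`
on `W ≠ 0` are `U(J)(𝒪_v)`-spherical for all but finitely many `v`. [cite: FlathCorvallis1979, §2 Example 2] [cite: Bump1997, Prop. 3.4.2] -/
theorem isSpherical_localType_cofinite' (ω : Representation ℂ (finAdelic F E c N J) W) (hω : ω.IsAdmissible) [Nontrivial W]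
    {T : HeightOneSpectrum (𝓞 F) → Type w₄} [∀ v, AddCommGroup (T v)] [∀ v, Module ℂ (T v)]
    (τ : ∀ v, Representation ℂ (localPi E c N J v) (T v)) (hirr : ∀ v, (τ v).IsIrreducible)
    (hτ : ∀ v, isotypicComponent (MonoidAlgebra ℂ (localPi E c N J v)) (Representation.asModule (ω.comp (inclPlace F E c N J v)))
      (Representation.asModule (τ v)) = ⊤) :
    ∀ᶠ v in cofinite, (τ v).IsSpherical (localInt E c N J v) :=
  isSpherical_localType_cofinite F E c N J ω τ hω fun v => ⟨hirr v, hτ v⟩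

end UnitaryGroup

end Literature.NumberTheory.Automorphic

end
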